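import Literature.AlgebraicGeometry.Resolution.DefectLinearlyDisjoint
import Literature.AlgebraicGeometry.Resolution.ValuationFiniteRank
import Literature.AlgebraicGeometry.Resolution.FiniteRankOverPrimeField
import Literature.AlgebraicGeometry.Resolution.GeneralizedStabilityFiniteRankLemmas
import Literature.AlgebraicGeometry.Resolution.GeneralizedStabilityFiniteRank
import Literature.AlgebraicGeometry.Resolution.GeneralizedStabilityRankOneProofs
import Literature.AlgebraicGeometry.Resolution.DefectTransport
import Mathlib.FieldTheory.Normal.Closure
import Mathlib.FieldTheory.Fixed
import Mathlib.FieldTheory.IsAlgClosed.AlgebraicClosure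
import Mathlib.FieldTheory.AlgebraicClosure
import Mathlib.Algebra.Algebra.ZMod
import HarnessLib

/-!
# Generalized stability for `K(t)`: the reduction to ground fields of finite rank (Kuhlmann 2010, Lemma 5.3) — proofs

Topic: `Literature/AlgebraicGeometry/Resolution` (valued function fields). We PROVE the named
fact `Kuhlmann2010AlgClosedFiniteRankReduction` (`GeneralizedStabilityFiniteRank.lean`), the
content of the proof of **Lemma 5.3** of F.-V. Kuhlmann, *Elimination of ramification I: The
generalized stability theorem*, Trans. AMS 362 (2010) 5697–5727 = arXiv:1003.5678 (p. 18):

> **Lemma 5.3.** To prove (R2), it suffices to prove (R3) … *Proof.* … we have to show that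
> `(K(t),v)` is a defectless field … Since `k₁` is finitely generated over its prime field, the
> rank of `(k₁,v)` and thus also of its algebraic closure `(k,v)` must be finite by
> Corollary 2.7 … Hence if we assume that (R3) holds, then we obtain that `(k(t),v)` is a
> defectless field … `(K(t),v)` is a defectless field.

for `F = K(t)` with `t` value-transcendental over the algebraically closed `K`: if `(k(t), v)`
is defectless for every algebraically closed `k ⊆ K` over which it has finite rank, then
`(K(t), v)` is a defectless field. The printed proof works in the HENSELIZATION (Thm. 2.14,
valuation regularity Lemma 2.20/2.23, Cor. 2.21, Prop. 2.24); the proof given here stays at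
finite level and is henselization-free:

1. Given `E | F` finite, pass to its normal closure `N | F` (inside an algebraic closure of
   `E`) and the copy `E_N ≅ E` of `E` in `N`; fix `F`-bases `b` of `N` and `b_E` of `E_N`.
2. The structure constants of `N` and `E_N`, the coordinates of `1`, of `b_E` in `b`, and the
   matrices of the finitely many `σ ∈ Aut(N | F)` are finitely many elements of `F = K(t)`,
   quotients of polynomials in `t` with finitely many coefficients `S ⊆ K`. Let `k` be the
   relative algebraic closure in `K` of the field `k₀(S)` generated over the prime field: an
   algebraically closed subfield (Mathlib's `algebraicClosure`), and `F' = k(t)` contains all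
   these constants (`aeval_div_aeval_mem_adjoin_of_coeff_mem`).
3. `(k(t), v)` has finite rank (`finite_overrings_of_adjoin_eq_top_of_isAlgebraic`: `k(t)` is
   algebraic over `k₀(S)(t)`, and the rank is pushed up along `k₀ ⊆ k₀(S) ⊆ k(t)` by the
   relative bound of `ValuationFiniteRank.lean`, starting from the prime field,
   `FiniteRankOverPrimeField.lean`; this is Cor. 2.7), so `(F', v)` is defectless by
   hypothesis.
4. The elements of `N` (resp. `E_N`) whose coordinates lie in `F'` form intermediate fields
   `N₀ ⊇ E₀` over `F'` (`exists_intermediateField_coords`) with `[E₀ : F'] = [E : F]`, `N₀`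
   stable under `Aut(N | F)`; `vF/vF'` is torsion free
   (`exists_valuation_eq_of_pow_eq_of_isAlgClosed`: `vK(t) = vK ⊕ ℤvt`, `vk` divisible) and
   `F'v = kv` is algebraically closed (`isAlgClosed_residueField_adjoin`, Lemma 2.5/2.1).
5. `IsDefectlessIn.of_form` (`DefectLinearlyDisjoint.lean`): every extension of `v|F'` to `E₀`
   is the trace of an extension of `v` to `E` (conjugation theorem in the normal extension
   `N₀ | F'`, base change of automorphisms), with `e` at least as large and `f ≥ 1 = f₀`; with
   the fundamental inequality, `(F, v)` is defectless in `E_N ≅ E`.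

With `GeneralizedStabilityRankOneProofs.lean` (Lemma 5.4, proved) the trust base of
`Kuhlmann2010StabilityAlgClosedValueTranscendental` is now exactly the two rank-one cases of
(R4) (`GeneralizedStabilityRankOne.lean`):
`Kuhlmann2010StabilityAlgClosedValueTranscendental.of_rankOne'`; and that of
`Kuhlmann2010Stability` is Cor. 2.25 plus these (`Kuhlmann2010Stability.of_descent_of_rankOne'`).

## Content (everything PROVED)

* `exists_intermediateField_coords` — forms cut out by coordinates are intermediate fields.
* `exists_eq_aeval_div_aeval`, `aeval_mem_adjoin_of_coeff_mem`,
  `aeval_div_aeval_mem_adjoin_of_coeff_mem` — rational functions with coefficients in `k`.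
* `valueTranscendental_adjoin`, `adjoin_gen_eq_top`, `exists_valuation_eq_of_pow_eq_of_isAlgClosed`,
  `isAlgClosed_residueField_adjoin` — the valued subfield `k(t) ⊆ K(t)`.
* `isAlgebraic_bot_bot`, `finite_overrings_primeSubfield`, `finite_overrings_adjoin_finset`,
  `finite_overrings_of_adjoin_eq_top_of_isAlgebraic` — finite rank of `k(t)` (Cor. 2.7).
* `Kuhlmann2010AlgClosedFiniteRankReduction_holds` — the named fact.
* `Kuhlmann2010StabilityAlgClosedValueTranscendental.of_rankOne'`,
  `Kuhlmann2010StabilityValueTranscendental.of_descent_of_rankOne'`,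
  `Kuhlmann2010Stability.of_descent_of_rankOne'` — assembly with Lemma 5.4 and Lemmas 5.1–5.2.

## Sources

* F.-V. Kuhlmann, loc. cit., §5, Lemma 5.3 and its proof (p. 18 of arXiv:1003.5678); §2.1
  (Lemma 2.1, Lemma 2.5, Cor. 2.7), §2.4 (Lemma 2.19, Lemma 2.20, Prop. 2.24).
* N. Bourbaki, *Algèbre commutative* VI §8 no. 6, Prop. 7 Cor. 1 (conjugation), VI §10 no. 3
  (rank and transcendence degree). [folklore]
-/

noncomputable section

open IsLocalRing Polynomial
open scoped Pointwise

namespace Literature.AlgebraicGeometry.Resolution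

universe u

/-! ### Forms defined by coordinates: construction -/

section FormConstruction

variable {F' F A : Type u} [Field F'] [Field F] [Field A] [Algebra F' F] [Algebra F A]
  [Algebra F' A] [IsScalarTower F' F A]
variable {κ : Type*} [Fintype κ] (b : Module.Basis κ F A)

/-- **Existence of the form.** If the structure constants of a finite field extension `A | F`
in an `F`-basis `b` and the coordinates of `1` lie in (the image of) `F'`, then the elements of
`A` all of whose `b`-coordinates lie in `F'` form an intermediate field of `A | F'` (a
subalgebra; inverses because it is finite-dimensional over `F'`). [folklore] -/
theorem exists_intermediateField_coords
    (hmul : ∀ i j l, b.repr (b i * b j) l ∈ (algebraMap F' F).range)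
    (hone : ∀ l, b.repr 1 l ∈ (algebraMap F' F).range) :
    ∃ A₀ : IntermediateField F' A, ∀ x : A, x ∈ A₀ ↔ ∀ l, b.repr x l ∈ (algebraMap F' F).range := by
  classical
  -- the subalgebra
  let A₁ : Subalgebra F' A :=
    { carrier := {x | ∀ l, b.repr x l ∈ (algebraMap F' F).range}
      mul_mem' := by
        intro x y hx hy l
        have hxy : x * y = ∑ i, ∑ j, (b.repr x i * b.repr y j) • (b i * b j) := by
          conv_lhs => rw [← b.sum_repr x, ← b.sum_repr y]
          rw [Finset.sum_mul_sum]
          refine Finset.sum_congr rfl fun i _ => Finset.sum_congr rfl fun j _ => ?_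
          rw [smul_mul_smul_comm]
        rw [hxy, map_sum, Finsupp.finsetSum_apply]
        refine Subring.sum_mem _ fun i _ => ?_
        rw [map_sum, Finsupp.finsetSum_apply]
        refine Subring.sum_mem _ fun j _ => ?_
        rw [map_smul, Finsupp.smul_apply, smul_eq_mul]
        exact Subring.mul_mem _ (Subring.mul_mem _ (hx i) (hy j)) (hmul i j l)
      one_mem' := hone
      add_mem' := by
        intro x y hx hy l
        rw [map_add, Finsupp.add_apply]
        exact Subring.add_mem _ (hx l) (hy l)
      zero_mem' := by
        intro l
        rw [map_zero, Finsupp.zero_apply]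
        exact Subring.zero_mem _
      algebraMap_mem' := by
        intro c l
        rw [IsScalarTower.algebraMap_apply F' F A, Algebra.algebraMap_eq_smul_one, map_smul,
          Finsupp.smul_apply, smul_eq_mul]
        exact Subring.mul_mem _ ⟨c, rfl⟩ (hone l) }
  have hmemA₁ : ∀ x : A, x ∈ A₁ ↔ ∀ l, b.repr x l ∈ (algebraMap F' F).range := fun x => Iff.rfl
  -- it is finite-dimensional over `F'`: contained in the `F'`-span of `b`
  have hle : Subalgebra.toSubmodule A₁ ≤ Submodule.span F' (Set.range b) := by
    intro x hx
    choose r hr using (hmemA₁ x).mp hx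
    rw [eq_sum_smul_of_coords b r hr]
    exact Submodule.sum_mem _ fun l _ => Submodule.smul_mem _ _ (Submodule.subset_span ⟨l, rfl⟩)
  haveI : Module.Finite F' (Submodule.span F' (Set.range b)) :=
    Module.Finite.span_of_finite F' (Set.finite_range b)
  haveI : Module.Finite F' (Subalgebra.toSubmodule A₁) :=
    Module.Finite.of_injective (Submodule.inclusion hle) (Submodule.inclusion_injective hle)
  haveI : Module.Finite F' A₁ := Module.Finite.equiv (Subalgebra.toSubmoduleEquiv A₁)
  haveI : Algebra.IsAlgebraic F' A₁ := Algebra.IsAlgebraic.of_finite F' A₁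
  -- hence a field
  refine ⟨{ A₁ with
    inv_mem' := fun x hx => ?_ }, fun x => Iff.rfl⟩
  have halg : IsAlgebraic F' ((⟨x, hx⟩ : A₁) : A) :=
    (Algebra.IsAlgebraic.isAlgebraic (⟨x, hx⟩ : A₁)).algHom A₁.val
  exact A₁.inv_mem_of_algebraic halg

end FormConstruction

/-! ### Rational functions with coefficients in a subfield -/

section Coefficients

variable {K F : Type u} [Field K] [Field F] [Algebra K F]

/-- Every element of `K(t)` is a quotient of two polynomial expressions in `t`. [folklore] -/
theorem exists_eq_aeval_div_aeval {t : F} (hgen : IntermediateField.adjoin K ({t} : Set F) = ⊤)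
    (c : F) : ∃ p q : K[X], c = aeval t p / aeval t q := by
  have hc : c ∈ IntermediateField.adjoin K ({t} : Set F) := by rw [hgen]; exact IntermediateField.mem_top
  exact (IntermediateField.mem_adjoin_simple_iff (F := K) c).mp hc

variable (k : Type u) [Field k] [Algebra k K] [Algebra k F] [IsScalarTower k K F]

/-- A polynomial expression in `t` whose coefficients come from the subfield `k → K` lies in
`k(t) ⊆ F`. [folklore] -/
theorem aeval_mem_adjoin_of_coeff_mem {p : K[X]} (hp : ∀ i, p.coeff i ∈ (algebraMap k K).range)
    (t : F) : aeval t p ∈ IntermediateField.adjoin k ({t} : Set F) := by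
  rw [aeval_eq_sum_range]
  refine sum_mem fun i _ => ?_
  rw [Algebra.smul_def]
  refine mul_mem ?_ (pow_mem (IntermediateField.subset_adjoin _ _ (Set.mem_singleton t)) _)
  obtain ⟨c, hc⟩ := hp i
  rw [← hc, ← IsScalarTower.algebraMap_apply k K F]
  exact IntermediateField.algebraMap_mem _ _

/-- A quotient of two such expressions lies in `k(t)` as well. [folklore] -/
theorem aeval_div_aeval_mem_adjoin_of_coeff_mem {p q : K[X]}
    (hp : ∀ i, p.coeff i ∈ (algebraMap k K).range) (hq : ∀ i, q.coeff i ∈ (algebraMap k K).range)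
    (t : F) : aeval t p / aeval t q ∈ IntermediateField.adjoin k ({t} : Set F) :=
  div_mem (aeval_mem_adjoin_of_coeff_mem k hp t) (aeval_mem_adjoin_of_coeff_mem k hq t)

end Coefficients

/-! ### The subfield `k(t) ⊆ K(t)` over an algebraically closed `k ⊆ K` -/

section SmallField

variable {K F : Type u} [Field K] [Field F] [Algebra K F] (O : ValuationSubring F) (t : F)
  (hvt : ∀ n : ℕ, 0 < n → ∀ c : K, O.valuation t ^ n ≠ O.valuation (algebraMap K F c))
  (hgen : IntermediateField.adjoin K ({t} : Set F) = ⊤)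
  (k : Type u) [Field k] [Algebra k K] [Algebra k F] [IsScalarTower k K F]

include hvt in
/-- `t` is value-transcendental over the subfield `k ⊆ K` as well, for the valuation ring
`k(t) ∩ F°` of `k(t)`. [folklore] -/
theorem valueTranscendental_adjoin (ht : t ∈ IntermediateField.adjoin k ({t} : Set F)) :
    ∀ n : ℕ, 0 < n → ∀ c : k,
      (O.comap (algebraMap (IntermediateField.adjoin k ({t} : Set F)) F)).valuation ⟨t, ht⟩ ^ n ≠
      (O.comap (algebraMap (IntermediateField.adjoin k ({t} : Set F)) F)).valuation
        (algebraMap k (IntermediateField.adjoin k ({t} : Set F)) c) := by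
  set M : IntermediateField k F := IntermediateField.adjoin k ({t} : Set F)
  intro n hn c h
  have h' : O.valuation t ^ n = O.valuation (algebraMap k F c) := by
    have h1 := congrArg (valueGroupHom M O) h
    rw [map_pow, valueGroupHom_valuation, valueGroupHom_valuation,
      ← IsScalarTower.algebraMap_apply k M F] at h1
    exact h1
  refine hvt n hn (algebraMap k K c) ?_
  rw [h', IsScalarTower.algebraMap_apply k K F]

omit [Algebra k K] [IsScalarTower k K F] in
/-- `k(t)` is generated by `t` over `k` (as an extension of `k` in its own right). [folklore] -/
theorem adjoin_gen_eq_top (ht : t ∈ IntermediateField.adjoin k ({t} : Set F)) :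
    IntermediateField.adjoin k ({(⟨t, ht⟩ : IntermediateField.adjoin k ({t} : Set F))} :
      Set (IntermediateField.adjoin k ({t} : Set F))) = ⊤ := by
  apply IntermediateField.lift_injective
  rw [IntermediateField.lift_adjoin, IntermediateField.lift_top, Set.image_singleton]

include hvt hgen in
/-- **`vK(t)/vk(t)` is torsion free** for an algebraically closed `k ⊆ K` and `t`
value-transcendental: if `v(c)^n = v(c')` with `c ∈ K(t)`, `c' ∈ k(t)^×`, `n ≥ 1`, then `v(c)`
is the value of an element of `k(t)`. PROOF: `v(c) = v(d) v(t)^m`, `v(c') = v(d') v(t)^{m'}`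
with `d ∈ K`, `d' ∈ k`, `m, m' ∈ ℤ` (Lemma 2.5: `vK(t) = vK ⊕ ℤvt`); comparing, `m' = n m` and
`v(d)^n = v(d')`; as `k` is algebraically closed, `d' = d₁^n` with `d₁ ∈ k`, so `v(d) = v(d₁)` and
`v(c) = v(d₁ t^m)`. [folklore] -/
theorem exists_valuation_eq_of_pow_eq_of_isAlgClosed [IsAlgClosed k]
    (ht : t ∈ IntermediateField.adjoin k ({t} : Set F)) (c : F) (n : ℕ) (hn : 0 < n)
    (h : ∃ c' : IntermediateField.adjoin k ({t} : Set F), c' ≠ 0 ∧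
      O.valuation c ^ n = O.valuation (algebraMap (IntermediateField.adjoin k ({t} : Set F)) F c')) :
    ∃ c'' : IntermediateField.adjoin k ({t} : Set F),
      O.valuation c = O.valuation (algebraMap (IntermediateField.adjoin k ({t} : Set F)) F c'') := by
  set M : IntermediateField k F := IntermediateField.adjoin k ({t} : Set F)
  obtain ⟨c', hc'0, hcc'⟩ := h
  have hvt' := valueTranscendental_adjoin O t hvt k ht
  have hgen' := adjoin_gen_eq_top t k ht
  have ht0 : O.valuation t ≠ 0 :=
    (Valuation.ne_zero_iff _).mpr (ne_zero_of_valueTranscendental O hvt)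
  -- `c ≠ 0`
  have hc0 : c ≠ 0 := by
    rintro rfl
    rw [map_zero, zero_pow hn.ne', eq_comm, Valuation.zero_iff, map_eq_zero] at hcc'
    exact hc'0 hcc'
  -- `v(c) = v(d) v(t)^m`, `v(c') = v(d') v(t)^{m'}`
  obtain ⟨m, d, hcv⟩ := exists_valuation_eq_of_valueTranscendental O hvt hgen hc0
  obtain ⟨m', d', hc'v⟩ := exists_valuation_eq_of_valueTranscendental (O.comap (algebraMap M F))
    hvt' hgen' hc'0
  have hc'vF : O.valuation (algebraMap M F c') =
      O.valuation (algebraMap k F d') * O.valuation t ^ m' := by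
    have h1 := congrArg (valueGroupHom M O) hc'v
    rw [map_mul, map_zpow₀, valueGroupHom_valuation, valueGroupHom_valuation,
      valueGroupHom_valuation, ← IsScalarTower.algebraMap_apply k M F] at h1
    exact h1
  have hd0 : O.valuation (algebraMap K F d) ≠ 0 := by
    intro h0
    rw [h0, zero_mul, Valuation.zero_iff] at hcv
    exact hc0 hcv
  have hd'0 : O.valuation (algebraMap k F d') ≠ 0 := by
    intro h0
    rw [h0, zero_mul, Valuation.zero_iff, map_eq_zero] at hc'vF
    exact hc'0 hc'vF
  -- compare: `v(d)^n v(t)^(m n) = v(d') v(t)^(m')`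
  have key : O.valuation (algebraMap K F d) ^ n * O.valuation t ^ (m * n) =
      O.valuation (algebraMap k F d') * O.valuation t ^ m' := by
    rw [← hc'vF, ← hcc', hcv, mul_pow, ← zpow_natCast (O.valuation t ^ m) n, ← zpow_mul]
  -- `v(t)^(m' - m n) = v(d^n / d')`, so `m' = m n`
  have hexp : m' = m * n := by
    have h2 : O.valuation t ^ (m' - m * n) =
        O.valuation (algebraMap K F (d ^ n / algebraMap k K d')) := by
      rw [map_div₀, map_div₀, map_pow, map_pow, ← IsScalarTower.algebraMap_apply, zpow_sub₀ ht0,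
        div_eq_div_iff (zpow_ne_zero _ ht0) hd'0, mul_comm]
      exact key.symm
    have := eq_zero_of_valuation_zpow_eq O hvt (m' - m * n) _ h2
    omega
  rw [hexp] at key
  have hdd' : O.valuation (algebraMap K F d) ^ n = O.valuation (algebraMap k F d') :=
    mul_right_cancel₀ (zpow_ne_zero _ ht0) key
  -- `d' = d₁^n` in the algebraically closed `k`
  obtain ⟨d₁, hd₁⟩ := IsAlgClosed.exists_pow_nat_eq d' hn
  rw [← hd₁, map_pow, map_pow] at hdd'
  have hvd : O.valuation (algebraMap K F d) = O.valuation (algebraMap k F d₁) :=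
    valuation_eq_of_pow_eq O hn.ne' hdd'
  -- `v(c) = v(d₁ t^m)`
  refine ⟨algebraMap k M d₁ * ⟨t, ht⟩ ^ m, ?_⟩
  rw [hcv, hvd, map_mul, map_zpow₀, map_mul, map_zpow₀, ← IsScalarTower.algebraMap_apply]
  rfl

include hvt in
/-- **`k(t)v = kv` is algebraically closed** for `k ⊆ K` algebraically closed and `t`
value-transcendental (Lemma 2.5 / Lemma 2.1). [folklore] -/
theorem isAlgClosed_residueField_adjoin [IsAlgClosed k]
    (ht : t ∈ IntermediateField.adjoin k ({t} : Set F)) :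
    IsAlgClosed (ResidueField (O.comap (algebraMap (IntermediateField.adjoin k ({t} : Set F)) F))) :=
  isAlgClosed_residueField_of_residueSubfield_eq_top (K := k) _
    (residueSubfield_eq_top_of_valueTranscendental _ (valueTranscendental_adjoin O t hvt k ht)
      (adjoin_gen_eq_top t k ht))

end SmallField

/-! ### Finite rank of `k(t)` for `k` algebraic over a finitely generated field -/

section FiniteRank

/-- The prime subfield is algebraic over itself (it has no proper subfields). [folklore] -/
theorem isAlgebraic_bot_bot (K : Type u) [Field K] :
    Algebra.IsAlgebraic (⊥ : Subfield (⊥ : Subfield K)) (⊥ : Subfield K) := by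
  refine ⟨fun x => ?_⟩
  have hx : x ∈ (⊥ : Subfield (⊥ : Subfield K)) := by
    have h1 : (x : K) ∈ ((⊥ : Subfield (⊥ : Subfield K)).map (⊥ : Subfield K).subtype) :=
      (bot_le : (⊥ : Subfield K) ≤ _) x.2
    obtain ⟨y, hy, hyx⟩ := Subfield.mem_map.mp h1
    have : y = x := Subtype.ext hyx
    exact this ▸ hy
  exact isAlgebraic_algebraMap (⟨x, hx⟩ : (⊥ : Subfield (⊥ : Subfield K)))

/-- A valuation ring of the prime subfield has finitely many overrings (Cor. 2.7 with
`tr.deg = 0`; `FiniteRankOverPrimeField.lean`). [folklore] -/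
theorem finite_overrings_primeSubfield (K : Type u) [Field K] (P : ValuationSubring (⊥ : Subfield K)) :
    Finite {S : ValuationSubring (⊥ : Subfield K) // P ≤ S} := by
  haveI := isAlgebraic_bot_bot K
  refine finite_overrings_of_trdeg_bot_lt_aleph0 P ?_
  rw [trdeg_eq_zero]
  exact Cardinal.aleph0_pos

/-- For a finite set `S ⊆ K`, the field `k₀(S)` generated over the prime subfield `k₀` has
finite rank for every valuation (it is generated by `S` over `k₀` inside itself, hence of
transcendence degree `≤ #S`). [folklore] -/
theorem finite_overrings_adjoin_finset {K : Type u} [Field K] (S : Finset K)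
    (P : ValuationSubring (IntermediateField.adjoin (⊥ : Subfield K) (S : Set K))) :
    Finite {S' : ValuationSubring (IntermediateField.adjoin (⊥ : Subfield K) (S : Set K)) //
      P ≤ S'} := by
  classical
  haveI := finite_overrings_primeSubfield K
    (P.comap (algebraMap (⊥ : Subfield K) (IntermediateField.adjoin (⊥ : Subfield K) (S : Set K))))
  -- `S` as a finite subset `s₀` of `k₀(S)`, generating it over `k₀`
  have hSsub : (S : Set K) ⊆ Set.range (Subtype.val :
      IntermediateField.adjoin (⊥ : Subfield K) (S : Set K) → K) := by
    intro c hc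
    exact ⟨⟨c, IntermediateField.subset_adjoin _ _ hc⟩, rfl⟩
  let s₀ : Finset (IntermediateField.adjoin (⊥ : Subfield K) (S : Set K)) :=
    S.preimage Subtype.val Subtype.val_injective.injOn
  have hs₀ : IntermediateField.adjoin (⊥ : Subfield K)
      (s₀ : Set (IntermediateField.adjoin (⊥ : Subfield K) (S : Set K))) = ⊤ := by
    apply IntermediateField.lift_injective
    rw [IntermediateField.lift_adjoin, IntermediateField.lift_top]
    simp only [s₀, Finset.coe_preimage]
    rw [Set.image_preimage_eq_of_subset hSsub]
  haveI : Algebra.IsAlgebraic (IntermediateField.adjoin (⊥ : Subfield K)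
      (s₀ : Set (IntermediateField.adjoin (⊥ : Subfield K) (S : Set K))))
      (IntermediateField.adjoin (⊥ : Subfield K) (S : Set K)) := by
    rw [hs₀]
    exact ⟨fun x => isAlgebraic_algebraMap
      (⟨x, IntermediateField.mem_top⟩ : (⊤ : IntermediateField (⊥ : Subfield K)
        (IntermediateField.adjoin (⊥ : Subfield K) (S : Set K))))⟩
  exact finite_overrings_of_finite_comap_of_isAlgebraic_adjoin (k := (⊥ : Subfield K)) P s₀

/-- **Finite rank of `k(t')`**: if every valuation ring of `K₀` has finitely many overrings
(e.g. `K₀ = k₀(S)`), `k | K₀` is algebraic and `L = k(t')` is generated over `k` by one element,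
then every valuation ring of `L` has finitely many overrings: `L` is algebraic over `K₀(t')`,
so the relative bound of `ValuationFiniteRank.lean` applies along `K₀ ⊆ K₀(t') ⊆ L`
(Kuhlmann 2010, Cor. 2.7, in the form needed for Lemma 5.3). [folklore] -/
theorem finite_overrings_of_adjoin_eq_top_of_isAlgebraic {K₀ k L : Type u} [Field K₀] [Field k]
    [Field L] [Algebra K₀ k] [Algebra k L] [Algebra K₀ L] [IsScalarTower K₀ k L]
    [Algebra.IsAlgebraic K₀ k] (hK₀ : ∀ P : ValuationSubring K₀, Finite {S : ValuationSubring K₀ // P ≤ S})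
    (t' : L) (hgen : IntermediateField.adjoin k ({t'} : Set L) = ⊤) (V : ValuationSubring L) :
    Finite {S' : ValuationSubring L // V ≤ S'} := by
  classical
  haveI := hK₀ (V.comap (algebraMap K₀ L))
  -- `L` is algebraic over `K₁ = K₀(t')`: the algebraic closure of `K₁` in `L` contains `k`, `t'`
  let K₁ : IntermediateField K₀ L := IntermediateField.adjoin K₀ ({t'} : Set L)
  let B : IntermediateField K₁ L := algebraicClosure K₁ L
  have hBk : ∀ c : k, algebraMap k L c ∈ B := fun c =>
    (mem_algebraicClosure_iff).mpr
      ((Algebra.IsAlgebraic.isAlgebraic (R := K₀) c).algebraMap.tower_top (L := K₁))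
  let T : IntermediateField k L := B.toSubfield.toIntermediateField hBk
  have hT : ∀ x : L, x ∈ T := by
    have hle : IntermediateField.adjoin k ({t'} : Set L) ≤ T := by
      rw [IntermediateField.adjoin_le_iff, Set.singleton_subset_iff]
      change t' ∈ B
      exact (mem_algebraicClosure_iff).mpr (isAlgebraic_algebraMap
        (⟨t', IntermediateField.mem_adjoin_simple_self K₀ t'⟩ : K₁))
    rw [hgen] at hle
    exact fun x => hle IntermediateField.mem_top
  haveI halg : Algebra.IsAlgebraic K₁ L :=
    ⟨fun x => (mem_algebraicClosure_iff).mp (show x ∈ B from hT x)⟩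
  have hcoe : ((({t'} : Finset L) : Set L)) = {t'} := Finset.coe_singleton t'
  exact finite_overrings_of_finite_comap_of_isAlgebraic_adjoin (k := K₀) V ({t'} : Finset L)
    (halg := by rw [hcoe]; exact halg)

end FiniteRank

/-! ### Lemma 5.3 for `K(t)`: the named fact, proved -/

section Main

/-- **Kuhlmann 2010, Lemma 5.3 for `F = K(t)` with a value-transcendental generator over an
algebraically closed `K`: PROOF of the named fact `Kuhlmann2010AlgClosedFiniteRankReduction`**
(`GeneralizedStabilityFiniteRank.lean`): if `(k(t), v)` is defectless for every algebraically
closed `k ⊆ K` over which it has finite rank, then `(K(t), v)` is a defectless field. The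
printed proof (p. 18) descends a finite extension `K(t)^h(a₁,…,a_n)` of the HENSELIZATION to
`k(t)^h` for `k` the algebraic closure in `K` of a finitely generated field and concludes by
Thm. 2.14, Cor. 2.21 and Prop. 2.24. Here, henselization-free: given `E | F` finite, embed it in
its normal closure `N | F`; let `k` be the relative algebraic closure in `K` of the field
generated over the prime field by the (finitely many) `K`-coefficients of the structure
constants of `N` and `E`, of the coordinates of `1` and of an `F`-basis of `E`, and of the
matrices of `Aut(N | F)`, in `F`-bases of `N` and `E` — an algebraically closed field such that
`(k(t'), w)` has finite rank for every valuation and every `t'`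
(`finite_overrings_of_adjoin_eq_top_of_isAlgebraic`; Cor. 2.7). Then `F' = k(t)` carries the
`F'`-forms `N₀ ⊇ E₀` of `N ⊇ E` cut out by "coordinates in `F'`"
(`exists_intermediateField_coords`), `N₀` is `Aut(N | F)`-stable, `(F', v)` is defectless by
hypothesis, `vF/vF'` is torsion free (`exists_valuation_eq_of_pow_eq_of_isAlgClosed`) and
`F'v = kv` is algebraically closed (`isAlgClosed_residueField_adjoin`); so `(F, v)` is
defectless in `E` by `IsDefectlessIn.of_form` (`DefectLinearlyDisjoint.lean`: conjugation of the
extensions of `v` in the normal extension `N₀ | F'` and the fundamental inequality).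
[cite: Kuhlmann2010, Section 5, Lemma 5.3] -/
theorem Kuhlmann2010AlgClosedFiniteRankReduction_holds :
    Kuhlmann2010AlgClosedFiniteRankReduction.{u} := by
  intro K F _ _ _ _ O t hvt hgen hk E _ _ hfinE
  haveI := hfinE
  classical
  /- Step 1: the normal closure `N` of `E | F` and the copy `EN ≅ E` of `E` inside it. -/
  haveI : Algebra.IsAlgebraic F E := Algebra.IsAlgebraic.of_finite F E
  haveI : IsAlgClosure F (AlgebraicClosure E) := IsAlgClosure.ofAlgebraic F E (AlgebraicClosure E)
  let N : Type u := IntermediateField.normalClosure F E (AlgebraicClosure E)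
  let ψ : E →ₐ[F] N := IsScalarTower.toAlgHom F E N
  let EN : IntermediateField F N := ψ.fieldRange
  let ψE : E ≃ₐ[F] EN := AlgEquiv.ofInjectiveField ψ
  /- Step 2: bases and the finite set `C` of constants in `F`. -/
  let b := Module.finBasis F N
  let bE := Module.finBasis F EN
  let ι := Fin (Module.finrank F N)
  let ιE := Fin (Module.finrank F EN)
  let C : Finset F :=
    (Finset.univ.image fun p : ι × ι × ι => b.repr (b p.1 * b p.2.1) p.2.2) ∪
    (Finset.univ.image fun l : ι => b.repr 1 l) ∪
    (Finset.univ.image fun p : (N ≃ₐ[F] N) × ι × ι => b.repr (p.1 (b p.2.1)) p.2.2) ∪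
    (Finset.univ.image fun p : ιE × ι => b.repr ((bE p.1 : EN) : N) p.2) ∪
    (Finset.univ.image fun p : ιE × ιE × ιE => bE.repr (bE p.1 * bE p.2.1) p.2.2) ∪
    (Finset.univ.image fun l : ιE => bE.repr 1 l)
  have hC1 : ∀ i j l, b.repr (b i * b j) l ∈ C := fun i j l => by
    simp only [C, Finset.mem_union, Finset.mem_image, Finset.mem_univ, true_and]
    exact Or.inl (Or.inl (Or.inl (Or.inl (Or.inl ⟨(i, j, l), rfl⟩))))
  have hC2 : ∀ l, b.repr 1 l ∈ C := fun l => by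
    simp only [C, Finset.mem_union, Finset.mem_image, Finset.mem_univ, true_and]
    exact Or.inl (Or.inl (Or.inl (Or.inl (Or.inr ⟨l, rfl⟩))))
  have hC3 : ∀ (σ : N ≃ₐ[F] N) j l, b.repr (σ (b j)) l ∈ C := fun σ j l => by
    simp only [C, Finset.mem_union, Finset.mem_image, Finset.mem_univ, true_and]
    exact Or.inl (Or.inl (Or.inl (Or.inr ⟨(σ, j, l), rfl⟩)))
  have hC4 : ∀ i l, b.repr ((bE i : EN) : N) l ∈ C := fun i l => by
    simp only [C, Finset.mem_union, Finset.mem_image, Finset.mem_univ, true_and]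
    exact Or.inl (Or.inl (Or.inr ⟨(i, l), rfl⟩))
  have hC5 : ∀ i j l, bE.repr (bE i * bE j) l ∈ C := fun i j l => by
    simp only [C, Finset.mem_union, Finset.mem_image, Finset.mem_univ, true_and]
    exact Or.inl (Or.inr ⟨(i, j, l), rfl⟩)
  have hC6 : ∀ l, bE.repr 1 l ∈ C := fun l => by
    simp only [C, Finset.mem_union, Finset.mem_image, Finset.mem_univ, true_and]
    exact Or.inr ⟨l, rfl⟩
  /- Step 3: their `K`-coefficients and the small algebraically closed field `k ⊆ K`. -/
  choose pn pd hpq using exists_eq_aeval_div_aeval hgen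
  let S : Finset K := C.biUnion fun c => (pn c).coeffs ∪ (pd c).coeffs
  let K₀ : IntermediateField (⊥ : Subfield K) K := IntermediateField.adjoin (⊥ : Subfield K) (S : Set K)
  let kK : IntermediateField K₀ K := algebraicClosure K₀ K
  let k : Type u := kK
  haveI : IsAlgClosed k := IsAlgClosure.isAlgClosed K₀
  have hSk : ∀ c ∈ S, c ∈ (algebraMap k K).range := fun c hc =>
    ⟨⟨c, IntermediateField.algebraMap_mem kK ⟨c, IntermediateField.subset_adjoin _ _ hc⟩⟩, rfl⟩
  /- Step 4: `F' = k(t)`; the constants lie in `F'`. -/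
  let M : IntermediateField k F := IntermediateField.adjoin k ({t} : Set F)
  have htM : t ∈ M := IntermediateField.mem_adjoin_simple_self k t
  have hcoeff : ∀ c ∈ C, ∀ (p : K[X]), p = pn c ∨ p = pd c → ∀ i, p.coeff i ∈ (algebraMap k K).range := by
    intro c hc p hp i
    by_cases h0 : p.coeff i = 0
    · exact ⟨0, by rw [h0, map_zero]⟩
    apply hSk
    rw [Finset.mem_biUnion]
    refine ⟨c, hc, ?_⟩
    rw [Finset.mem_union]
    rcases hp with rfl | rfl
    · exact Or.inl (Polynomial.coeff_mem_coeffs h0)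
    · exact Or.inr (Polynomial.coeff_mem_coeffs h0)
  have hCM : ∀ c ∈ C, c ∈ (algebraMap M F).range := by
    intro c hc
    have hcM : c ∈ M := by
      rw [hpq c]
      exact aeval_div_aeval_mem_adjoin_of_coeff_mem k (hcoeff c hc _ (Or.inl rfl))
        (hcoeff c hc _ (Or.inr rfl)) t
    exact ⟨⟨c, hcM⟩, rfl⟩
  /- Step 5: the forms `N₀` of `N` and `E₀` of `EN` over `F' = M`. -/
  obtain ⟨N₀, hN₀⟩ := exists_intermediateField_coords (F' := M) b
    (fun i j l => hCM _ (hC1 i j l)) (fun l => hCM _ (hC2 l))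
  obtain ⟨E₀', hE₀'⟩ := exists_intermediateField_coords (F' := M) (A := EN) bE
    (fun i j l => hCM _ (hC5 i j l)) (fun l => hCM _ (hC6 l))
  let θ : EN →ₐ[M] N := IsScalarTower.toAlgHom M EN N
  let E₀ : IntermediateField M N := E₀'.map θ
  -- `N₀` is stable under `Aut(N | F)`
  have hstab : ∀ σ : N ≃ₐ[F] N, ∀ x ∈ N₀, σ x ∈ N₀ := by
    intro σ x hx
    rw [hN₀] at hx ⊢
    intro l
    have hσx : σ x = ∑ j, b.repr x j • σ (b j) := by
      conv_lhs => rw [← b.sum_repr x]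
      rw [map_sum]
      exact Finset.sum_congr rfl fun j _ => map_smul σ _ _
    rw [hσx, map_sum, Finsupp.finsetSum_apply]
    refine Subring.sum_mem _ fun j _ => ?_
    rw [map_smul, Finsupp.smul_apply, smul_eq_mul]
    exact Subring.mul_mem _ (hx j) (hCM _ (hC3 σ j l))
  -- `E₀ ⊆ EN`, `E₀ ⊆ N₀`, `[E₀ : F'] = [EN : F]`
  have hE₀E : (E₀ : Set N) ⊆ EN := by
    rintro _ ⟨y, -, rfl⟩
    exact (y : EN).2
  have hE₀N₀ : E₀ ≤ N₀ := by
    rintro _ ⟨y, hy, rfl⟩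
    change (y : N) ∈ N₀
    rw [hN₀]
    intro l
    replace hy : y ∈ E₀' := hy
    rw [hE₀'] at hy
    have hyN : ((y : EN) : N) = ∑ i, bE.repr y i • ((bE i : EN) : N) := by
      conv_lhs => rw [← bE.sum_repr y]
      rw [IntermediateField.coe_sum]
      exact Finset.sum_congr rfl fun i _ => IntermediateField.coe_smul _ _ _
    rw [hyN, map_sum, Finsupp.finsetSum_apply]
    refine Subring.sum_mem _ fun i _ => ?_
    rw [map_smul, Finsupp.smul_apply, smul_eq_mul]
    exact Subring.mul_mem _ (hy i) (hCM _ (hC4 i l))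
  have hdeg : Module.finrank M E₀ = Module.finrank F EN := by
    rw [← finrank_form bE E₀' hE₀', ← (IntermediateField.equivMap E₀' θ).toLinearEquiv.finrank_eq]
  /- Step 6: the hypotheses on `F' = k(t)`: finite rank, defectless, torsion free, residue field. -/
  have hfinM : Finite {S' : ValuationSubring M // O.comap (algebraMap M F) ≤ S'} := by
    exact finite_overrings_of_adjoin_eq_top_of_isAlgebraic (K₀ := K₀) (k := k)
      (finite_overrings_adjoin_finset S) (⟨t, htM⟩ : M) (adjoin_gen_eq_top t k htM) _
  have hdefM : IsDefectlessField M (O.comap (algebraMap M F)) := hk k hfinM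
  haveI : FiniteDimensional M E₀ := by
    apply Module.finite_of_finrank_pos
    rw [hdeg]
    exact Module.finrank_pos
  have hdef : IsDefectlessIn M (O.comap (algebraMap M F)) E₀ := hdefM E₀ inferInstance
  have htf := exists_valuation_eq_of_pow_eq_of_isAlgClosed O t hvt hgen k htM
  have hres := isAlgClosed_residueField_adjoin O t hvt k htM
  /- Step 7: `(F, O)` is defectless in `EN`, hence in `E ≅ EN`. -/
  have hEN : IsDefectlessIn F O EN :=
    IsDefectlessIn.of_form b N₀ hN₀ hstab E₀ hE₀N₀ O EN hE₀E hdeg hdef htf hres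
  refine IsDefectlessIn.congr (RingEquiv.refl F) ψE.symm.toRingEquiv (fun x => ?_) (by rfl) hEN
  change ψE.symm (algebraMap F EN x) = algebraMap F E x
  rw [AlgEquiv.commutes]

/-! ### Assembly: what the stability theorem for `K(t)` now rests on -/

/-- **(R2) for `K(t)` from (R4) in rank one alone**: with Lemma 5.3 proved
(`Kuhlmann2010AlgClosedFiniteRankReduction_holds`) and Lemma 5.4 proved
(`Kuhlmann2010StabilityAlgClosedFiniteRank.of_rankOne`, `GeneralizedStabilityRankOneProofs.lean`),
the named fact `Kuhlmann2010StabilityAlgClosedValueTranscendental` follows from the two rank-one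
cases of (R4) (`GeneralizedStabilityRankOne.lean`). PROVED.
[cite: Kuhlmann2010, Section 5, Lemmas 5.3–5.4] -/
theorem Kuhlmann2010StabilityAlgClosedValueTranscendental.of_rankOne'
    (h4v : Kuhlmann2010StabilityRankOneValueTranscendental.{u})
    (h4r : Kuhlmann2010StabilityRankOneResidueTranscendental.{u}) :
    Kuhlmann2010StabilityAlgClosedValueTranscendental.{u} :=
  Kuhlmann2010StabilityAlgClosedValueTranscendental.of_rankOne
    Kuhlmann2010AlgClosedFiniteRankReduction_holds h4v h4r

/-- **Thm. 1.1 for `K(t)` with `t` value-transcendental over a defectless `K`** from Cor. 2.25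
(`Kuhlmann2010DefectlessDescent`) and (R4) in rank one (Lemma 5.2 composed with the proved
Lemmas 5.3–5.4). PROVED. [cite: Kuhlmann2010, Section 5, Lemmas 5.2–5.4] -/
theorem Kuhlmann2010StabilityValueTranscendental.of_descent_of_rankOne'
    (hD : Kuhlmann2010DefectlessDescent.{u})
    (h4v : Kuhlmann2010StabilityRankOneValueTranscendental.{u})
    (h4r : Kuhlmann2010StabilityRankOneResidueTranscendental.{u}) :
    Kuhlmann2010StabilityValueTranscendental.{u} :=
  Kuhlmann2010StabilityValueTranscendental.of_rankOne hD
    Kuhlmann2010AlgClosedFiniteRankReduction_holds h4v h4r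

/-- **Kuhlmann 2010, Thm. 1.1 over a trivially valued ground field** from Cor. 2.25 and (R4) in
rank one: the fundamental inequality, Cor. 2.6, Cor. 2.16, Lemmas 5.1, 5.3, 5.4 being PROVED, the
trust base of `Kuhlmann2010Stability` along the printed proof is now `Kuhlmann2010DefectlessDescent`
(Cor. 2.25) and the two rank-one facts (R4). PROVED.
[cite: Kuhlmann2010, Thm. 1.1 and Section 5, Lemmas 5.1–5.4] -/
theorem Kuhlmann2010Stability.of_descent_of_rankOne' (hD : Kuhlmann2010DefectlessDescent.{u})
    (h4v : Kuhlmann2010StabilityRankOneValueTranscendental.{u})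
    (h4r : Kuhlmann2010StabilityRankOneResidueTranscendental.{u}) : Kuhlmann2010Stability.{u} :=
  Kuhlmann2010Stability.of_rankOne hD Kuhlmann2010AlgClosedFiniteRankReduction_holds h4v h4r

end Main

end Literature.AlgebraicGeometry.Resolution
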